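/-
Copyright (c) 2026 the pub-hodgecm-mathlib formalisation cell (harness21).  Prover seat hodgecm-mathlib-K2E3-p32 (g0), HCML Track B «K2-LIT» (close-out strike line L4
`stub_StCharTS`), h413 = `stmt-HodgeConjecture-24833`, line `K2_E3_EllipticInputs`, unit U4 «Keys», PART «U4Keys» socket :155 (U4f-χ₁-ram-one-d0B)
`sig_K2E3KeysThmTwoContractingRamifiedCharOneDepthZeroNormTrivial` (LINE-LEAD K2E3-plan (g4) EMIT #5, deal D162, cell «U4-RAM»; plan of record K2E3-p06 (g4) DESIGN-M2-v2 (O2),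
step Z2-B «the type plane in Branch B»), CM part: THE BRANCH-B COMPATIBILITY LETTER `hθw` OF ★ `K2E3IwahoriTypeBasisMackey` ON `U(Φ₃)(L⁺_v)` — `θ(s) = (χδ^{1∕2})(w₀ s w₀⁻¹)` on
`I ∩ w₀⁻¹ P w₀` from `χ₁(u·σu) = 1` (the leaf's `hB`).  2026-09-04.
-/
import Summits.HodgeConjecture.HodgeConjecture.Theorems.K2E3BranchATypeLettersCM     -- ★ Z2A-3c (iii) (K2E3-p06 (g4)): `theta_eq_tau_of_mem` (the letter `hθH`); brings ★ `twist_comp_proj_apply_one`, `w₀_mem_K0`, ★ Z2A-3b (`coe_eA_apply`, `isUnit_apply_zero_zero_of_mem`, `map_mem_inf_of_mem`), the frame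
import Literature.NumberTheory.Automorphic.CMPrincipalSeriesSpherical                  -- ★ `coe_torusEntry_proj_borelTriple` (`(torusEntry i (proj p)) = p_{ii}`)
import HarnessLib

/-!
# K2 ∕ E3 «EllipticInputs», unit U4 «Keys» — (U4f-χ₁-ram-one-d0B) step Z2-B, CM part: THE BRANCH-B LETTER `hθw` ON `U(Φ₃)(L⁺_v)`
# «for `s ∈ I` with `w₀ s w₀⁻¹ ∈ P`: `θ(s) = ((χ ∘ proj) ⊗ δ^{1∕2})(w₀ s w₀⁻¹)·1`, GIVEN `χ₁(u·σu) = 1` on units»   [Roche1998 §3–§4; Keys1984 §7 Thm (2); Rogawski1990 §12.1]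

Cell `pub/hodgecm-mathlib`, crux H413 = `stmt-HodgeConjecture-24833`, route of record `HCCMUnconditional`; chair K2-lead (g2), LINE-LEAD∕dealer K2E3-plan (g4), architect K2E3-p25
(g3); cell «U4-RAM».  THEOREMS ONLY (no `def`, no `instance`, no `notation`, no named-fact hypothesis, no `sorry`); lane `--supports stmt-HodgeConjecture-24833 --as helper`,
count-neutral.  NOT THE PAYER: the socket :155 stays OPEN.

THE POINT.  ★ `K2E3IwahoriTypeBasisMackey.exists_normalised_typeBasis[_of_fin_two]` (this seat) builds the type basis `(f₁, f_w)` of `i(χ₁, 1)` from two local compatibilities: `hθH`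
(`θ = χδ^{1∕2}` on `I ∩ P`, ★ p06 `K2E3BranchATypeLettersCM.theta_eq_tau_of_mem`) and `hθw` (`θ(s) = χδ^{1∕2}(w₀ s w₀⁻¹)` for `s ∈ I` with `w₀ s w₀⁻¹ ∈ P`).  THIS FILE proves `hθw`
in K2E3-p06 (g4)'s frame `(eA, heA, ϖ, g₁, K0, K1, I)` with `w₀` the element of matrix `Φ₃` (`hw₀`) and `θ(g) = χ₁(g₀₀)` (the `dif`-function of ★ Z2A-5): the right-hand side is
`δ^{1∕2}(p)·χ₁(torusEntry₀(proj p))` (★ `twist_comp_proj_apply_one`, `p = w₀ s w₀⁻¹`), `δ^{1∕2}(p) = 1` because `p ∈ K₀` is compact (★ `w₀_mem_K0`, ★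
`rootDeltaChar_eq_one_of_mem_of_isClosed_of_isCompact`), `torusEntry_i(proj p) = p_{ii}` (★ `coe_torusEntry_proj_borelTriple`); the torus relation of `proj p ∈ T` (★
`glDiagonal_mem_unitaryGroupOfForm_antidiagonal_iff`: `σ(d₂)·d₀ = 1`) gives `p₀₀ = σ(p₂₂)⁻¹`, and `p₂₂ = (w₀ s w₀⁻¹)₂₂ = s₀₀` (§1: `w₀² = 1`, `(w₀ g w₀)_{ij} = g_{rev i, rev j}`, from ★
`StdForm.antidiagonal_over_apply` over the ring `L ⊗ L⁺_v`); so RHS `= χ₁(σ(s₀₀)⁻¹)` while LHS `= χ₁(s₀₀)` (`s₀₀` a unit with `|s₀₀|_w = 1` on `I`, ★ `v_apply_zero_zero_eq_one_of_mem_inf` read through `eA`), and they agree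
iff `χ₁(s₀₀ · σ s₀₀) = 1` — the leaf's Branch-B binder `hB` VERBATIM.
* §1 `antidiagonal_mul_mul_antidiagonal_apply`, `antidiagonal_mul_antidiagonal` (`Φ₃MΦ₃`, `Φ₃² = 1` over the ring `L ⊗ L⁺_v`),
  `coe_weylConj_apply` (`(w₀ g w₀⁻¹)_{ij} = g_{rev i, rev j}`).
* §2 `v_apply_zero_zero_eq_one_of_mem` (`|(s₀₀)_{w′}| = 1` for `s ∈ I`), `torusEntry_zero_proj_eq_inv_conj` (`torusEntry₀(proj p) = (σ torusEntry₂(proj p))⁻¹`),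
  **`theta_eq_tau_weylConj_of_mem`** — the letter `hθw` of ★ `exists_normalised_typeBasis_of_fin_two` at `U(Φ₃)(L⁺_v)` (with `g₀ = w₀`), from `hB`.
HONEST LABEL.  HC_CM is proved only modulo the 7 printed citations (2 remaining named inputs: hLiu418 = `stmt-HodgeConjecture-24832`, h413 = `stmt-HodgeConjecture-24833`) until rung 0
closes; count-neutral — this file does NOT pay the leaf; no printed citation is discharged.  Still owed for the CM assembly of Z2-B: the open subgroup `C = I₊` with `θ = 1` (depth zero),
`w₀ = eA⁻¹(w_w)` against ★ `cover∕disj_borel_I`, and the analytic letters (Z3).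

## References
* [Roche1998] A. Roche, Ann. Sci. ÉNS (4) 31 (1998), §3–§4 (`W_χ`; `I w₀ I` supports a `χ̃`-spherical vector iff `χ̃ = ʷχ̃` on `I ∩ ʷI`).
* [Keys1984] D. Keys, Compositio Math. 51 (1984), §3, §7 Theorem (2) p. 126.
* [Rogawski1990] J. D. Rogawski, Ann. of Math. Stud. 123 (1990), §1.10 p. 9 (`M`, `w₀ = Φ`), §12.1 p. 171.
* [Casselman1995] W. Casselman, *Introduction to the theory of admissible representations of `p`-adic reductive groups* (1995), §1.4, §6.3.
-/

set_option autoImplicit false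
-- the mandated namespace has the single-problem summit's repeated segment (`HodgeConjecture.HodgeConjecture`)
set_option linter.dupNamespace false

noncomputable section

open NumberField IsDedekindDomain
open scoped Matrix MatrixGroups WithZero Valued
open Literature.NumberTheory Literature.NumberTheory.Automorphic Literature.NumberTheory.Automorphic.UnitaryGroup
open Literature.NumberTheory.Rogawski1990

namespace Summit.HodgeConjecture.HodgeConjecture.Cruxes.H413.K2E3BranchBTypeLettersCM

open Summit.HodgeConjecture.HodgeConjecture.Cruxes.H413
open Summit.HodgeConjecture.HodgeConjecture.Cruxes.H413.K2E3DepthZeroIwahoriCharacterCM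
open Summit.HodgeConjecture.HodgeConjecture.Cruxes.H413.K2E3BranchATorusWitnessCM

variable (L : Type) [Field L] [NumberField L] [IsCMField L] (v : HeightOneSpectrum (𝓞 ↥(maximalRealSubfield L)))
  (w : PlacesOver L v) (hw : IsCMField.complexConj L • w.1 = w.1)
  (eA : Gqs L v ≃ₜ* ↥(unitaryGroupOfForm (galAdicCompletionMap (L := L) (IsCMField.complexConj L) hw) ((StdForm.antidiagonal 3).over (w.1.adicCompletion L))))
  (heA : ∀ g : Gqs L v,
    ((eA g : ↥(unitaryGroupOfForm (galAdicCompletionMap (L := L) (IsCMField.complexConj L) hw) ((StdForm.antidiagonal 3).over (w.1.adicCompletion L)))) :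
        GL (Fin 3) (w.1.adicCompletion L)) =
      ((localNonsplitEquiv (IsCMField.complexConj L) (qsForm L) (IsCMField.complexConj_ne_one L) w hw g :
        ↥(unitaryGroupOfForm (galAdicCompletionMap (L := L) (IsCMField.complexConj L) hw) (placeForm (qsForm L) w.1))) : GL (Fin 3) (w.1.adicCompletion L)))
  {ϖ : w.1.adicCompletion L} (hϖ : Valued.v ϖ = WithZero.exp (-1 : ℤ))
  (g₁ : GL (Fin 3) (w.1.adicCompletion L)) (hg₁ : (g₁ : Matrix (Fin 3) (Fin 3) (w.1.adicCompletion L)) = Matrix.diagonal ![(1 : w.1.adicCompletion L), 1, ϖ])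
  (K0 K1 I : Subgroup (Gqs L v))
  (hK0 : K0 = ((glInt 3 (w.1.adicCompletion L)).subgroupOf
    (unitaryGroupOfForm (galAdicCompletionMap (L := L) (IsCMField.complexConj L) hw) ((StdForm.antidiagonal 3).over (w.1.adicCompletion L)))).comap
      eA.toMulEquiv.toMonoidHom)
  (hK1 : K1 = (((glInt 3 (w.1.adicCompletion L)).map (MulAut.conj g₁).toMonoidHom).subgroupOf
    (unitaryGroupOfForm (galAdicCompletionMap (L := L) (IsCMField.complexConj L) hw) ((StdForm.antidiagonal 3).over (w.1.adicCompletion L)))).comap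
      eA.toMulEquiv.toMonoidHom)
  (hI : I = K0 ⊓ K1)
  (w₀ : Gqs L v) (hw₀ : Units.val (w₀.val : GL (Fin 3) (LocalRing L v)) = cmLocalForm L 3 v)

/-! ## §1 `w₀² = 1` and the entries of `w₀ g w₀⁻¹` (any commutative ring: `Φ₃ = antidiag(1,1,1)`) -/

omit [IsCMField L] in
/-- `Φ₃ · M · Φ₃` reverses rows and columns: `(Φ₃ M Φ₃)_{ij} = M_{rev i, rev j}` (entries ★ `StdForm.antidiagonal_over_apply`). [cite: Rogawski1990, §1.9 p. 8] -/
theorem antidiagonal_mul_mul_antidiagonal_apply (M : Matrix (Fin 3) (Fin 3) (LocalRing L v)) (i j : Fin 3) :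
    ((StdForm.antidiagonal 3).over (LocalRing L v) * M * (StdForm.antidiagonal 3).over (LocalRing L v)) i j = M i.rev j.rev := by
  have r0 : (0 : Fin 3).rev = 2 := by decide
  have r1 : (1 : Fin 3).rev = 1 := by decide
  have r2 : (2 : Fin 3).rev = 0 := by decide
  fin_cases i <;> fin_cases j <;>
    simp [Matrix.mul_apply, Fin.sum_univ_three, StdForm.antidiagonal_over_apply, r0, r1, r2]

omit [IsCMField L] in
/-- `Φ₃ · Φ₃ = 1`. [cite: Rogawski1990, §1.9 p. 8] -/
theorem antidiagonal_mul_antidiagonal : (StdForm.antidiagonal 3).over (LocalRing L v) * (StdForm.antidiagonal 3).over (LocalRing L v) = 1 := by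
  ext i j
  have h := antidiagonal_mul_mul_antidiagonal_apply L v 1 i j
  rw [mul_one] at h
  rw [h, Matrix.one_apply, Matrix.one_apply]
  by_cases hij : i = j
  · subst hij; rw [if_pos rfl, if_pos rfl]
  · rw [if_neg hij, if_neg (fun h' => hij (Fin.rev_injective h'))]

include hw₀ in
set_option maxHeartbeats 1600000 in
set_option synthInstance.maxHeartbeats 400000 in
-- the `U(Φ₃)(L⁺_v)`-valued products are read in two definitionally equal carriers (`Gqs L v` and the matrix subgroup); unification is slow (class of ★ Z2A-3c (ii))
/-- **`(w₀ g w₀⁻¹)_{ij} = g_{rev i, rev j}`** (`w₀⁻¹ = w₀ = Φ₃`). [cite: Rogawski1990, §1.10 p. 9] -/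
theorem coe_weylConj_apply (g : Gqs L v) (i j : Fin 3) :
    (((w₀ * g * w₀⁻¹ : Gqs L v).val : GL (Fin 3) (LocalRing L v)) : Matrix (Fin 3) (Fin 3) (LocalRing L v)) i j =
      ((g.val : GL (Fin 3) (LocalRing L v)) : Matrix (Fin 3) (Fin 3) (LocalRing L v)) i.rev j.rev := by
  -- `w₀ · w₀ = 1` (`Φ₃² = 1`; cf. ★ `F0P3cStCharTSDomGeneralH.weylElt₂_mul_self`), so `w₀⁻¹ = w₀`
  have hsq : w₀ * w₀ = 1 := by
    apply Subtype.ext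
    apply Units.ext
    change (w₀.val : GL (Fin 3) (LocalRing L v)).val * (w₀.val : GL (Fin 3) (LocalRing L v)).val = 1
    rw [hw₀, cmLocalForm_eq_over, antidiagonal_mul_antidiagonal]
  have hinv : w₀⁻¹ = w₀ := inv_eq_of_mul_eq_one_right hsq
  rw [hinv]
  change ((w₀.val : GL (Fin 3) (LocalRing L v)).val * (g.val : GL (Fin 3) (LocalRing L v)).val * (w₀.val : GL (Fin 3) (LocalRing L v)).val) i j = _
  rw [hw₀, cmLocalForm_eq_over, antidiagonal_mul_mul_antidiagonal_apply]

/-! ## §2 The letter `hθw` -/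

include hw heA hϖ hg₁ hK0 hK1 hI in
set_option maxHeartbeats 1600000 in
set_option synthInstance.maxHeartbeats 400000 in
-- two carriers, slow unification (as above)
/-- **`|(s₀₀)_{w′}|_{w′} = 1` for `s ∈ I`** and every place `w′ ∣ v` (non-split: `w′ = w`; ★ `v_apply_zero_zero_eq_one_of_mem_inf` on the place Iwahori, read through `eA`).
[cite: BruhatTits1972, (4.4.4)] [cite: Casselman1995, §1.4] -/
theorem v_apply_zero_zero_eq_one_of_mem {s : Gqs L v} (hs : s ∈ I) (w' : PlacesOver L v) :
    Valued.v ((((s.val : GL (Fin 3) (LocalRing L v)) : Matrix (Fin 3) (Fin 3) (LocalRing L v)) 0 0) w') = 1 := by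
  rw [PlacesOver.eq_of_smul_eq (IsCMField.complexConj L) (IsCMField.complexConj_ne_one L) w hw w', ← coe_eA_apply L v w hw eA heA s 0 0]
  exact K2E3IwahoriFactorisationThree.v_apply_zero_zero_eq_one_of_mem_inf (galAdicCompletionMap (L := L) (IsCMField.complexConj L) hw) rfl
    (fun x => valued_galAdicCompletionMap (L := L) (IsCMField.complexConj L) hw x) hϖ g₁ hg₁ (map_mem_inf_of_mem L v w hw eA g₁ K0 K1 I hK0 hK1 hI hs)

set_option maxHeartbeats 1600000 in
set_option synthInstance.maxHeartbeats 400000 in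
-- two carriers, slow unification (as above)
/-- **The torus relation on the Levi part of `p ∈ P`**: `torusEntry₀(proj p) · σ(torusEntry₂(proj p)) = 1` (`proj p = diag(d)` is unitary for `Φ₃`: `σ(d_{2−i}) d_i = 1`, ★
`glDiagonal_mem_unitaryGroupOfForm_antidiagonal_iff`). [cite: Rogawski1990, §1.10 p. 9] -/
theorem torusEntry_zero_mul_conj_torusEntry_two (p : ↥(cmBorelTriple L 3 v).P) :
    ((torusEntry (conjLocal L (IsCMField.complexConj L) v) (cmLocalForm L 3 v) 0 ((cmBorelTriple L 3 v).proj p) : (LocalRing L v)ˣ) : LocalRing L v) *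
      conjLocal L (IsCMField.complexConj L) v
        ((torusEntry (conjLocal L (IsCMField.complexConj L) v) (cmLocalForm L 3 v) 2 ((cmBorelTriple L 3 v).proj p) : (LocalRing L v)ˣ) : LocalRing L v) = 1 := by
  have hJ : cmLocalForm L 3 v = (StdForm.antidiagonal 3).over (LocalRing L v) := cmLocalForm_eq_over L 3 v
  obtain ⟨d, hd⟩ := (mem_torusU_iff _).1 ((cmBorelTriple L 3 v).proj p).2
  have hmemJ : glDiagonal 3 (LocalRing L v) d ∈ unitaryGroupOfForm (conjLocal L (IsCMField.complexConj L) v) (cmLocalForm L 3 v) := by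
    rw [hd]; exact ((cmBorelTriple L 3 v).proj p).1.2
  have hmem : glDiagonal 3 (LocalRing L v) d ∈ unitaryGroupOfForm (conjLocal L (IsCMField.complexConj L) v) ((StdForm.antidiagonal 3).over (LocalRing L v)) := by
    rw [← hJ]; exact hmemJ
  have hrel := (glDiagonal_mem_unitaryGroupOfForm_antidiagonal_iff (conjLocal L (IsCMField.complexConj L) v) 3 d).1 hmem 0
  rw [torusEntry_eq_of_glDiagonal_eq _ _ 0 _ d hd, torusEntry_eq_of_glDiagonal_eq _ _ 2 _ d hd, mul_comm]
  exact hrel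

open Classical in
include hw heA hϖ hg₁ hK0 hK1 hI hw₀ in
set_option maxHeartbeats 3200000 in
set_option synthInstance.maxHeartbeats 400000 in
-- two carriers, slow unification (as above)
/-- **THE BRANCH-B LETTER `hθw`.**  For `χ₁ : (L ⊗ L⁺_v)ˣ → ℂˣ` with `χ₁(u · σu) = 1` for every unit `u` with `|u_{w′}| = 1` (the leaf's `hB`: `χ₁ ∘ N = 1` on `𝒪ˣ`, `w₀ ∈ W_χ`), every `s ∈ I` whose
`w₀`-conjugate lies in `P` satisfies `θ(s) = ((χ∘proj) ⊗ δ^{1∕2})(w₀ s w₀⁻¹)·1`, where `θ(g) = χ₁(g₀₀)` is the depth-zero Iwahori character: both sides are `χ₁`-values of units of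
absolute value `1`, namely `χ₁(s₀₀)` and `χ₁(σ(s₀₀)⁻¹)` (§1–§2 above), equal by `hB`.  This is the hypothesis `hθw` (at `g₀ = w₀`) of ★ `K2E3IwahoriTypeBasisMackey.exists_normalised_typeBasis[_of_fin_two]`
for `Ind_P^{U(Φ₃)(L⁺_v)} (χ₁, 1)δ^{1∕2}`. [cite: Roche1998, §3–§4] [cite: Keys1984, §7 Theorem (2) p. 126] [cite: Rogawski1990, §12.1 p. 171] -/
theorem theta_eq_tau_weylConj_of_mem (χ₁ : (LocalRing L v)ˣ →* ℂˣ)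
    (hB : ∀ u : (LocalRing L v)ˣ, (∀ w' : PlacesOver L v, Valued.v ((u : LocalRing L v) w') = 1) →
      χ₁ (u * Units.map (conjLocal L (IsCMField.complexConj L) v : LocalRing L v →* LocalRing L v) u) = 1)
    (s : Gqs L v) (hsI : s ∈ I)
    (hsP : ((w₀ * s * w₀⁻¹ : Gqs L v) : ↥(unitaryGroupOfForm (conjLocal L (IsCMField.complexConj L) v) (cmLocalForm L 3 v))) ∈ (cmBorelTriple L 3 v).P) :
    (if h : IsUnit (((s.val : GL (Fin 3) (LocalRing L v)) : Matrix (Fin 3) (Fin 3) (LocalRing L v)) 0 0) then ((χ₁ h.unit : ℂˣ) : ℂ) else 0) =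
      (haveI := locallyCompactSpace_cmBorelU L 3 v
       (Representation.twist
          (((Representation.trivial ℂ ↥(torusU (conjLocal L (IsCMField.complexConj L) v) (cmLocalForm L 3 v)) ℂ).twist
            (cmTorusCharPair L v χ₁ 1)).comp (cmBorelTriple L 3 v).proj) (rootDeltaChar (cmBorelTriple L 3 v).P))
        ⟨((w₀ * s * w₀⁻¹ : Gqs L v) : ↥(unitaryGroupOfForm (conjLocal L (IsCMField.complexConj L) v) (cmLocalForm L 3 v))), hsP⟩ 1) := by
  haveI := locallyCompactSpace_cmBorelU L 3 v
  have hJ : cmLocalForm L 3 v = (StdForm.antidiagonal 3).over (LocalRing L v) := cmLocalForm_eq_over L 3 v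
  -- the left-hand side: `θ(s) = χ₁(u)`, `u = s₀₀` a unit with `|u_{w′}| = 1`
  have hU : IsUnit (((s.val : GL (Fin 3) (LocalRing L v)) : Matrix (Fin 3) (Fin 3) (LocalRing L v)) 0 0) :=
    isUnit_apply_zero_zero_of_mem L v w hw eA heA hϖ g₁ hg₁ K0 K1 I hK0 hK1 hI hsI
  have hu1 : ∀ w' : PlacesOver L v, Valued.v ((hU.unit : LocalRing L v) w') = 1 := fun w' => by
    rw [IsUnit.unit_spec]; exact v_apply_zero_zero_eq_one_of_mem L v w hw eA heA hϖ g₁ hg₁ K0 K1 I hK0 hK1 hI hsI w'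
  rw [dif_pos hU]
  -- the right-hand side: `δ^{1/2}(p) · χ₁(torusEntry₀ (proj p))`, `p = w₀ s w₀⁻¹ ∈ K₀`
  rw [twist_comp_proj_apply_one (cmBorelTriple L 3 v) (cmTorusCharPair L v χ₁ 1) (rootDeltaChar (cmBorelTriple L 3 v).P) ⟨_, hsP⟩]
  have hlev := F0P3cStCharTSStLevelsTransport.isOpen_isCompact_levels L v w hw eA g₁ K0 K1 I hK0 hK1 hI
  have hw0K : w₀ ∈ K0 := w₀_mem_K0 L v w hw eA heA K0 hK0 w₀ hw₀
  have hsK : s ∈ K0 := by rw [hI] at hsI; exact (Subgroup.mem_inf.1 hsI).1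
  have hxK : w₀ * s * w₀⁻¹ ∈ K0 := K0.mul_mem (K0.mul_mem hw0K hsK) (K0.inv_mem hw0K)
  have hδ : rootDeltaChar (cmBorelTriple L 3 v).P ⟨_, hsP⟩ = 1 :=
    rootDeltaChar_eq_one_of_mem_of_isClosed_of_isCompact (cmBorelTriple L 3 v).P
      (isClosed_borelU (conjLocal L (IsCMField.complexConj L) v) (cmLocalForm L 3 v)) (K := K0) hlev.1.2 hxK
  rw [hδ, Units.val_one, one_mul,
    show cmTorusCharPair L v χ₁ 1 = torusCharPair (conjLocal L (IsCMField.complexConj L) v) (cmLocalForm L 3 v) hJ 0 χ₁ 1 from rfl,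
    torusCharPair_apply, MonoidHom.one_apply, mul_one]
  -- `torusEntry₀(proj p) = (σ torusEntry₂(proj p))⁻¹` and `torusEntry₂(proj p) = p₂₂ = s₀₀ = u`
  set p : ↥(cmBorelTriple L 3 v).P := ⟨((w₀ * s * w₀⁻¹ : Gqs L v) : ↥(unitaryGroupOfForm (conjLocal L (IsCMField.complexConj L) v) (cmLocalForm L 3 v))), hsP⟩ with hp
  have he2 : torusEntry (conjLocal L (IsCMField.complexConj L) v) (cmLocalForm L 3 v) 2 ((cmBorelTriple L 3 v).proj p) = hU.unit := by
    apply Units.ext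
    rw [coe_torusEntry_proj_borelTriple, IsUnit.unit_spec]
    exact coe_weylConj_apply L v w₀ hw₀ s 2 2
  have he0 : torusEntry (conjLocal L (IsCMField.complexConj L) v) (cmLocalForm L 3 v) 0 ((cmBorelTriple L 3 v).proj p) =
      (Units.map (conjLocal L (IsCMField.complexConj L) v : LocalRing L v →* LocalRing L v) hU.unit)⁻¹ := by
    rw [eq_inv_iff_mul_eq_one]
    apply Units.ext
    rw [Units.val_mul, Units.coe_map, MonoidHom.coe_coe, ← he2, Units.val_one]
    exact torusEntry_zero_mul_conj_torusEntry_two L v p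
  rw [he0]
  -- `χ₁(u) = χ₁((σu)⁻¹)` from `χ₁(u · σu) = 1`
  have h := hB hU.unit hu1
  rw [map_mul, mul_eq_one_iff_eq_inv] at h
  rw [h, map_inv]

end Summit.HodgeConjecture.HodgeConjecture.Cruxes.H413.K2E3BranchBTypeLettersCM

end
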